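import Summits.BirchSwinnertonDyer.BirchSwinnertonDyer.Theorems.BiquadraticEisensteinDescentEisensteinHeartFlatCMInertBadKPrimeBiquadraticCMField
import Literature.NumberTheory.EllipticCurves.KatzPAdicLFunctionCMField
import Literature.NumberTheory.EllipticCurves.Rank1Residual.Predicates
import HarnessLib

set_option linter.dupNamespace false -- `Summit.BirchSwinnertonDyer.BirchSwinnertonDyer.Theorems.…` (summit = sub)
set_option autoImplicit false

/-!
# Crux `EisensteinHeartFlatCMInertBadKPrime` (stmt-BirchSwinnertonDyer-21341), line `hsieh-lambda`, layer 2 —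
# INSTANTIATION tranche 1b: decomposition of `p` in the biquadratic field `L = K_CM · K′`

Sequel of `…BiquadraticCMField.lean` (same seat, same conventions: THEOREMS ONLY, helper toward
stmt-BirchSwinnertonDyer-21341, nothing about the crux's input or BSD asserted).

## Setting and what is proved

`L` a number field with `[L : ℚ] = 4` containing a square root `x` of an integer `d` that is NOT a square modulo the
prime `p` (route: `d = d_CM = cmFieldDiscrOfJ W.j`, `p` inert in `K_CM` — `not_isSquare_of_cmInert` reads this off
`Rank1Residual.CMInert W p` for odd `p`), and a subfield `K ⊂ L` (route: the imaginary quadratic Heegner field `K′`)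
in which `p` has two distinct primes `𝔭 ≠ 𝔭′` (`p` split in `K′`).

* §3 every prime of `L` above `p` has residue degree `≥ 2` over `ℤ` (`inertiaDeg_ne_one`, `two_le_inertiaDeg`: a
  residue field with `p` elements would contain a square root of `d̄`), hence by the fundamental identity
  `∑ e·f = [L : ℚ] = 4` two distinct primes above `p` are ALL of them and each has `e = 1`, `f = 2`
  (`primes_above_eq_and_degrees`); over `K`: a prime of `L` above `𝔭` exists (`exists_liesOver`) and is UNIQUE
  (`liesOver_unique` — `𝔭` is inert in `L/K`), and `KatzCM.primesOver L p = {𝔓, 𝔓′}` with `𝔓 ∣ 𝔭`, `𝔓′ ∣ 𝔭′`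
  both unramified of residue degree `2` over `ℤ` (`primesOver_eq_pair`).
* §3′ bookkeeping at the route's hypotheses: `CMInert ⇒ d_CM` non-square mod `p` (`not_isSquare_of_cmInert`); `√d` is
  integral (`exists_ringOfIntegers_sq_eq`); a split prime of a quadratic field has `e = f = 1`
  (`ramificationIdx_inertiaDeg_eq_one_of_split`), so `√d ∉ K′` (`not_exists_sq_eq_of_split`, `sqrt_not_mem_range` —
  the hypothesis `hxK` of `…BiquadraticCMField.isCMField`); and relatively `e(𝔓|𝔭) = 1`, `f(𝔓|𝔭) = 2`
  (`ramificationIdx_inertiaDeg_relative`).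

References: [NeukirchANT1999] Ch. I §8 (fundamental identity, towers); [Hsieh2014mu] §1.1; [SilvermanATAEC1994]
App. A §3 (`d_CM`).
-/

noncomputable section

open scoped Classical NumberField Pointwise
open NumberField IsDedekindDomain Module

namespace Summit.BirchSwinnertonDyer.BirchSwinnertonDyer.Theorems.BiquadraticEisensteinDescentEisensteinHeartFlatCMInertBadKPrimeBiquadraticPrimes

open Literature.NumberTheory.EllipticCurves
open Summit.BirchSwinnertonDyer.BirchSwinnertonDyer.Theorems.BiquadraticEisensteinDescentEisensteinHeartFlatCMInertBadKPrimeBiquadraticCMField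

variable {K L : Type} [Field K] [NumberField K] [Field L] [NumberField L] [Algebra K L]

/-! ### §3 Decomposition of `p`: the primes above a prime inert in `ℚ(√d)` and split in `K` -/

section Decomposition

variable {p : ℕ} [hp : Fact p.Prime]

/-- `pℤ` is a maximal ideal. [folklore] -/
theorem isMaximal_span_natPrime : (Ideal.span {((p : ℕ) : ℤ)}).IsMaximal := by
  have hpr : Prime ((p : ℕ) : ℤ) := Nat.prime_iff_prime_int.mp hp.out
  haveI : (Ideal.span {((p : ℕ) : ℤ)}).IsPrime := (Ideal.span_singleton_prime hpr.ne_zero).mpr hpr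
  exact IsPrime.to_maximal_ideal (by
    rw [Ne, Ideal.span_singleton_eq_bot]
    exact hpr.ne_zero)

omit [NumberField L] in
/-- A prime of `𝓞 L` containing `p` lies over `pℤ`. [folklore] -/
theorem liesOver_span_of_mem {𝔓 : Ideal (𝓞 L)} [𝔓.IsPrime] (hP : ((p : ℕ) : 𝓞 L) ∈ 𝔓) :
    𝔓.LiesOver (Ideal.span {((p : ℕ) : ℤ)}) := by
  refine ⟨(isMaximal_span_natPrime (p := p)).eq_of_le (Ideal.IsPrime.under ℤ 𝔓).ne_top ?_⟩
  rw [Ideal.span_le, Set.singleton_subset_iff, SetLike.mem_coe, Ideal.mem_comap, map_natCast]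
  exact hP

omit [NumberField L] hp in
/-- Conversely a prime over `pℤ` contains `p`. [folklore] -/
theorem mem_of_liesOver_span {𝔓 : Ideal (𝓞 L)} [h : 𝔓.LiesOver (Ideal.span {((p : ℕ) : ℤ)})] :
    ((p : ℕ) : 𝓞 L) ∈ 𝔓 := by
  have hmem : ((p : ℕ) : ℤ) ∈ 𝔓.under ℤ := by
    rw [← h.over]; exact Ideal.mem_span_singleton_self _
  rw [Ideal.mem_comap, map_natCast] at hmem
  exact hmem

/-- A prime of `𝓞 L` containing the rational prime `p` is non-zero. [folklore] -/
theorem ne_bot_of_mem {𝔓 : Ideal (𝓞 L)} (hP : ((p : ℕ) : 𝓞 L) ∈ 𝔓) : 𝔓 ≠ ⊥ := by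
  intro h
  rw [h, Ideal.mem_bot, Nat.cast_eq_zero] at hP
  exact hp.out.ne_zero hP

/-- **No prime of `L` above `p` has residue degree one** when `L` contains a square root `x` of an integer `d` that
is NOT a square modulo `p` (`p` inert in `ℚ(√d)`): a residue field `𝓞_L/𝔓` with `p` elements would be `ℤ/p`, in
which `x̄² = d̄` has no solution. [cite: NeukirchANT1999, Ch. I §8] -/
theorem inertiaDeg_ne_one {d : ℤ} (hd : ¬ IsSquare ((d : ℤ) : ZMod p)) {x : 𝓞 L} (hx : x ^ 2 = (d : 𝓞 L))
    {𝔓 : Ideal (𝓞 L)} [𝔓.IsPrime] (hP : ((p : ℕ) : 𝓞 L) ∈ 𝔓) : 𝔓.inertiaDeg ℤ ≠ 1 := by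
  intro h1
  haveI := liesOver_span_of_mem hP
  have hnorm : (p : ℕ) ^ 𝔓.inertiaDeg ℤ = Ideal.absNorm 𝔓 := Ideal.pow_inertiaDeg p 𝔓
  rw [h1, pow_one] at hnorm
  haveI : Finite (𝓞 L ⧸ 𝔓) := Ideal.finiteQuotientOfFreeOfNeBot 𝔓 (ne_bot_of_mem hP)
  letI : Fintype (𝓞 L ⧸ 𝔓) := Fintype.ofFinite _
  have hcard : Fintype.card (𝓞 L ⧸ 𝔓) = p := by
    rw [← Nat.card_eq_fintype_card, ← Submodule.cardQuot_apply, ← Ideal.absNorm_apply, ← hnorm]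
  let e : ZMod p ≃+* 𝓞 L ⧸ 𝔓 := ZMod.ringEquivOfPrime (𝓞 L ⧸ 𝔓) hp.out hcard
  apply hd
  refine ⟨e.symm (Ideal.Quotient.mk 𝔓 x), ?_⟩
  rw [← sq, ← map_pow, ← map_pow, hx, map_intCast, map_intCast]

/-- Hence every prime of `L` above `p` has residue degree `≥ 2` over `ℤ`. [cite: NeukirchANT1999, Ch. I §8] -/
theorem two_le_inertiaDeg {d : ℤ} (hd : ¬ IsSquare ((d : ℤ) : ZMod p)) {x : 𝓞 L} (hx : x ^ 2 = (d : 𝓞 L))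
    {𝔓 : Ideal (𝓞 L)} [𝔓.IsPrime] (hP : ((p : ℕ) : 𝓞 L) ∈ 𝔓) : 2 ≤ 𝔓.inertiaDeg ℤ := by
  have h1 := inertiaDeg_ne_one hd hx hP
  have h0 : 0 < 𝔓.inertiaDeg ℤ := Ideal.inertiaDeg_pos 𝔓 ℤ
  omega

/-- **The decomposition of `p` in a quartic field containing `√d`, `d` a non-square mod `p`, with two distinct primes
above `p`**: these are ALL the primes above `p`, and each is unramified of residue degree `2` over `ℤ` (fundamental
identity `∑ e·f = [L : ℚ] = 4` with every `f ≥ 2`). [cite: NeukirchANT1999, Ch. I §8 (Prop. 8.2, fundamental identity)] -/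
theorem primes_above_eq_and_degrees (h4 : finrank ℚ L = 4) {d : ℤ} (hd : ¬ IsSquare ((d : ℤ) : ZMod p))
    {x : 𝓞 L} (hx : x ^ 2 = (d : 𝓞 L)) {𝔓₁ 𝔓₂ : HeightOneSpectrum (𝓞 L)}
    (h₁ : ((p : ℕ) : 𝓞 L) ∈ 𝔓₁.asIdeal) (h₂ : ((p : ℕ) : 𝓞 L) ∈ 𝔓₂.asIdeal) (hne : 𝔓₁ ≠ 𝔓₂) :
    (∀ 𝔔 : HeightOneSpectrum (𝓞 L), ((p : ℕ) : 𝓞 L) ∈ 𝔔.asIdeal → 𝔔 = 𝔓₁ ∨ 𝔔 = 𝔓₂) ∧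
    (∀ 𝔔 : HeightOneSpectrum (𝓞 L), ((p : ℕ) : 𝓞 L) ∈ 𝔔.asIdeal →
      𝔔.asIdeal.ramificationIdx ℤ = 1 ∧ 𝔔.asIdeal.inertiaDeg ℤ = 2) := by
  set P : Ideal ℤ := Ideal.span {((p : ℕ) : ℤ)} with hPdef
  haveI hPmax : P.IsMaximal := isMaximal_span_natPrime
  -- the fundamental identity
  have hsum := Ideal.sum_ramification_inertia_eq_finrank P (𝓞 L)
  rw [RingOfIntegers.rank, h4] at hsum
  -- every summand is at least `2`
  have hge : ∀ q : P.primesOver (𝓞 L), 2 ≤ q.1.ramificationIdx ℤ * q.1.inertiaDeg ℤ := by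
    intro q
    have hq : ((p : ℕ) : 𝓞 L) ∈ q.1 := mem_of_liesOver_span
    have hf := two_le_inertiaDeg hd hx hq
    have he : 0 < q.1.ramificationIdx ℤ := Ideal.ramificationIdx_pos q.1 ℤ
    nlinarith
  -- the two given primes as elements of `primesOver`
  haveI := 𝔓₁.isPrime
  haveI := 𝔓₂.isPrime
  haveI := liesOver_span_of_mem h₁
  haveI := liesOver_span_of_mem h₂
  set Q₁ : P.primesOver (𝓞 L) := Ideal.primesOver.mk P 𝔓₁.asIdeal with hQ₁
  set Q₂ : P.primesOver (𝓞 L) := Ideal.primesOver.mk P 𝔓₂.asIdeal with hQ₂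
  have hQne : Q₁ ≠ Q₂ := fun h ↦ hne (HeightOneSpectrum.ext (congrArg Subtype.val h))
  have hcard2 : Fintype.card (P.primesOver (𝓞 L)) ≤ 2 := by
    have h := Finset.card_nsmul_le_sum (Finset.univ : Finset (P.primesOver (𝓞 L))) _ 2 (fun q _ ↦ hge q)
    rw [hsum, smul_eq_mul] at h
    rw [← Finset.card_univ]
    omega
  have huniv : (Finset.univ : Finset (P.primesOver (𝓞 L))) = {Q₁, Q₂} := by
    symm
    apply Finset.eq_of_subset_of_card_le (Finset.subset_univ _)
    rw [Finset.card_pair hQne, Finset.card_univ]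
    exact hcard2
  have hmem : ∀ 𝔔 : HeightOneSpectrum (𝓞 L), ((p : ℕ) : 𝓞 L) ∈ 𝔔.asIdeal → 𝔔 = 𝔓₁ ∨ 𝔔 = 𝔓₂ := by
    intro 𝔔 hQ
    haveI := 𝔔.isPrime
    haveI := liesOver_span_of_mem hQ
    have hin : Ideal.primesOver.mk P 𝔔.asIdeal ∈ (Finset.univ : Finset (P.primesOver (𝓞 L))) :=
      Finset.mem_univ _
    rw [huniv, Finset.mem_insert, Finset.mem_singleton] at hin
    rcases hin with h | h
    · exact Or.inl (HeightOneSpectrum.ext (congrArg Subtype.val h))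
    · exact Or.inr (HeightOneSpectrum.ext (congrArg Subtype.val h))
  refine ⟨hmem, fun 𝔔 hQ ↦ ?_⟩
  -- the two summands are both `2`
  have hsum2 : Q₁.1.ramificationIdx ℤ * Q₁.1.inertiaDeg ℤ + Q₂.1.ramificationIdx ℤ * Q₂.1.inertiaDeg ℤ = 4 := by
    rw [← hsum, huniv, Finset.sum_pair hQne]
  have hval : ∀ q : P.primesOver (𝓞 L), q.1.ramificationIdx ℤ * q.1.inertiaDeg ℤ = 2 := by
    intro q
    have hq : q ∈ (Finset.univ : Finset (P.primesOver (𝓞 L))) := Finset.mem_univ q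
    rw [huniv, Finset.mem_insert, Finset.mem_singleton] at hq
    have g₁ := hge Q₁
    have g₂ := hge Q₂
    rcases hq with rfl | rfl <;> omega
  haveI := 𝔔.isPrime
  haveI := liesOver_span_of_mem hQ
  have hv := hval (Ideal.primesOver.mk P 𝔔.asIdeal)
  have hf := two_le_inertiaDeg hd hx hQ
  have he : 0 < 𝔔.asIdeal.ramificationIdx ℤ := Ideal.ramificationIdx_pos 𝔔.asIdeal ℤ
  constructor <;> nlinarith

omit hp [NumberField L] in
/-- **Over a prime of `K` there is a prime of `L`** (going up along `𝓞 K → 𝓞 L`). [cite: NeukirchANT1999, Ch. I §8] -/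
theorem exists_liesOver (𝔭 : HeightOneSpectrum (𝓞 K)) :
    ∃ 𝔓 : HeightOneSpectrum (𝓞 L), 𝔓.asIdeal.LiesOver 𝔭.asIdeal := by
  haveI := 𝔭.isMaximal
  obtain ⟨Q, hQmax, hQ⟩ := Ideal.exists_maximal_ideal_liesOver_of_isIntegral (S := 𝓞 L) 𝔭.asIdeal
  exact ⟨⟨Q, hQmax.isPrime, Ideal.ne_bot_of_liesOver_of_ne_bot 𝔭.ne_bot Q⟩, hQ⟩

omit hp [NumberField K] [NumberField L] in
/-- A prime of `L` over a prime of `K` containing `p` contains `p`. [folklore] -/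
theorem natCast_mem_of_liesOver {𝔭 : HeightOneSpectrum (𝓞 K)} (h𝔭 : ((p : ℕ) : 𝓞 K) ∈ 𝔭.asIdeal)
    {𝔓 : HeightOneSpectrum (𝓞 L)} [h : 𝔓.asIdeal.LiesOver 𝔭.asIdeal] : ((p : ℕ) : 𝓞 L) ∈ 𝔓.asIdeal := by
  have hmem : ((p : ℕ) : 𝓞 K) ∈ 𝔓.asIdeal.under (𝓞 K) := by rw [← h.over]; exact h𝔭
  rw [Ideal.mem_comap, map_natCast] at hmem
  exact hmem

omit hp [NumberField K] [NumberField L] in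
/-- Primes of `L` over distinct primes of `K` are distinct. [folklore] -/
theorem ne_of_liesOver_ne {𝔭 𝔭' : HeightOneSpectrum (𝓞 K)} (hne : 𝔭 ≠ 𝔭') {𝔓 𝔓' : HeightOneSpectrum (𝓞 L)}
    [h : 𝔓.asIdeal.LiesOver 𝔭.asIdeal] [h' : 𝔓'.asIdeal.LiesOver 𝔭'.asIdeal] : 𝔓 ≠ 𝔓' := by
  rintro rfl
  exact hne (HeightOneSpectrum.ext (h.over.trans h'.over.symm))

/-- **`𝔭` is inert in `L/K`: the prime of `L` above `𝔭` is unique**, for `[L : ℚ] = 4`, `√d ∈ L` with `d` a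
non-square mod `p`, and `𝔭 ≠ 𝔭′` two primes of `K` above `p`. [cite: NeukirchANT1999, Ch. I §8] -/
theorem liesOver_unique (h4 : finrank ℚ L = 4) {d : ℤ} (hd : ¬ IsSquare ((d : ℤ) : ZMod p))
    {x : 𝓞 L} (hx : x ^ 2 = (d : 𝓞 L)) {𝔭 𝔭' : HeightOneSpectrum (𝓞 K)}
    (h𝔭 : ((p : ℕ) : 𝓞 K) ∈ 𝔭.asIdeal) (h𝔭' : ((p : ℕ) : 𝓞 K) ∈ 𝔭'.asIdeal) (hne : 𝔭 ≠ 𝔭')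
    {𝔓₁ 𝔓₂ : HeightOneSpectrum (𝓞 L)} [𝔓₁.asIdeal.LiesOver 𝔭.asIdeal] [𝔓₂.asIdeal.LiesOver 𝔭.asIdeal] :
    𝔓₁ = 𝔓₂ := by
  obtain ⟨𝔓', h'⟩ := exists_liesOver (L := L) 𝔭'
  have hne₁ : 𝔓₁ ≠ 𝔓' := ne_of_liesOver_ne hne
  have hne₂ : 𝔓₂ ≠ 𝔓' := ne_of_liesOver_ne hne
  rcases (primes_above_eq_and_degrees h4 hd hx (natCast_mem_of_liesOver h𝔭) (natCast_mem_of_liesOver h𝔭')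
    hne₁).1 𝔓₂ (natCast_mem_of_liesOver h𝔭) with h | h
  · exact h.symm
  · exact absurd h hne₂

omit [NumberField K] in
/-- **The primes of `L` above `p` are exactly the prime `𝔓` above `𝔭` and the prime `𝔓′` above `𝔭′`**, each
unramified of residue degree `2` over `ℤ`; in the vocabulary of the Katz frame,
`KatzCM.primesOver L p = {𝔓, 𝔓′}`. [cite: NeukirchANT1999, Ch. I §8] [cite: Hsieh2014mu, §1.1] -/
theorem primesOver_eq_pair (h4 : finrank ℚ L = 4) {d : ℤ} (hd : ¬ IsSquare ((d : ℤ) : ZMod p))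
    {x : 𝓞 L} (hx : x ^ 2 = (d : 𝓞 L)) {𝔭 𝔭' : HeightOneSpectrum (𝓞 K)}
    (h𝔭 : ((p : ℕ) : 𝓞 K) ∈ 𝔭.asIdeal) (h𝔭' : ((p : ℕ) : 𝓞 K) ∈ 𝔭'.asIdeal) (hne : 𝔭 ≠ 𝔭')
    {𝔓 𝔓' : HeightOneSpectrum (𝓞 L)} [𝔓.asIdeal.LiesOver 𝔭.asIdeal] [𝔓'.asIdeal.LiesOver 𝔭'.asIdeal] :
    KatzCM.primesOver L p = {𝔓, 𝔓'} ∧ 𝔓 ≠ 𝔓' ∧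
      𝔓.asIdeal.ramificationIdx ℤ = 1 ∧ 𝔓.asIdeal.inertiaDeg ℤ = 2 ∧
      𝔓'.asIdeal.ramificationIdx ℤ = 1 ∧ 𝔓'.asIdeal.inertiaDeg ℤ = 2 := by
  have hne' : 𝔓 ≠ 𝔓' := ne_of_liesOver_ne hne
  have hP := natCast_mem_of_liesOver (L := L) (𝔓 := 𝔓) h𝔭
  have hP' := natCast_mem_of_liesOver (L := L) (𝔓 := 𝔓') h𝔭'
  obtain ⟨hall, hdeg⟩ := primes_above_eq_and_degrees h4 hd hx hP hP' hne'
  refine ⟨?_, hne', (hdeg 𝔓 hP).1, (hdeg 𝔓 hP).2, (hdeg 𝔓' hP').1, (hdeg 𝔓' hP').2⟩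
  ext 𝔔
  rw [KatzCM.mem_primesOver, Finset.mem_insert, Finset.mem_singleton]
  refine ⟨hall 𝔔, ?_⟩
  rintro (rfl | rfl)
  · exact hP
  · exact hP'

end Decomposition

/-! ### §3′ At the route's hypotheses: `CMInert`, integrality of `√d`, `√d ∉ K′`, relative degrees -/

section Route

variable {p : ℕ} [hp : Fact p.Prime]

omit [NumberField K] [Algebra K L] in
/-- **`CMInert W p` at odd `p` says `d_CM` is a non-square mod `p`** (`d_CM = cmFieldDiscrOfJ W.j`; the residual
class vocabulary `Rank1Residual.CMInert = ¬ CMRamified ∧ ¬ CMSplit` unfolded). [cite: SilvermanATAEC1994, App. A §3] -/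
theorem not_isSquare_of_cmInert {W : WeierstrassCurve ℚ} [W.IsElliptic] (hp2 : p ≠ 2)
    (h : Rank1Residual.CMInert W p) : ¬ IsSquare ((Rank1Residual.cmFieldDiscrOfJ W.j : ℤ) : ZMod p) := by
  intro hsq
  apply h.2
  refine ⟨h.1, ?_⟩
  rw [if_neg hp2]
  exact hsq

omit [NumberField K] [NumberField L] [Algebra K L] hp in
/-- A square root in `L` of an integer `d` lies in `𝓞 L` (root of the monic `X² − d`). [folklore] -/
theorem exists_ringOfIntegers_sq_eq {d : ℤ} {x : L} (hx : x ^ 2 = (d : L)) :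
    ∃ y : 𝓞 L, (y : L) = x ∧ y ^ 2 = (d : 𝓞 L) := by
  have hint : IsIntegral ℤ x := by
    refine IsIntegral.of_pow two_pos ?_
    rw [hx, ← eq_intCast (algebraMap ℤ L) d]
    exact isIntegral_algebraMap
  refine ⟨⟨x, hint⟩, rfl, ?_⟩
  apply RingOfIntegers.ext
  simp [hx]

omit [Algebra K L] in
/-- **A split prime of a quadratic field has residue degree and ramification index one**: if `[K : ℚ] = 2` and
`𝔭 ≠ 𝔭′` both lie above `p`, then `e(𝔭|p) = f(𝔭|p) = 1` (fundamental identity `∑ e f = 2` with two summands).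
[cite: NeukirchANT1999, Ch. I §8] -/
theorem ramificationIdx_inertiaDeg_eq_one_of_split (h2K : finrank ℚ K = 2) {𝔭 𝔭' : HeightOneSpectrum (𝓞 K)}
    (h𝔭 : ((p : ℕ) : 𝓞 K) ∈ 𝔭.asIdeal) (h𝔭' : ((p : ℕ) : 𝓞 K) ∈ 𝔭'.asIdeal) (hne : 𝔭 ≠ 𝔭') :
    𝔭.asIdeal.ramificationIdx ℤ = 1 ∧ 𝔭.asIdeal.inertiaDeg ℤ = 1 := by
  set P : Ideal ℤ := Ideal.span {((p : ℕ) : ℤ)} with hPdef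
  haveI hPmax : P.IsMaximal := isMaximal_span_natPrime
  have hsum := Ideal.sum_ramification_inertia_eq_finrank P (𝓞 K)
  rw [RingOfIntegers.rank, h2K] at hsum
  haveI := 𝔭.isPrime
  haveI := 𝔭'.isPrime
  haveI := liesOver_span_of_mem h𝔭
  haveI := liesOver_span_of_mem h𝔭'
  set Q₁ : P.primesOver (𝓞 K) := Ideal.primesOver.mk P 𝔭.asIdeal with hQ₁
  set Q₂ : P.primesOver (𝓞 K) := Ideal.primesOver.mk P 𝔭'.asIdeal with hQ₂
  have hQne : Q₁ ≠ Q₂ := fun h ↦ hne (HeightOneSpectrum.ext (congrArg Subtype.val h))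
  have hge : ∀ q : P.primesOver (𝓞 K), 1 ≤ q.1.ramificationIdx ℤ * q.1.inertiaDeg ℤ := fun q ↦
    Nat.one_le_iff_ne_zero.mpr (Nat.mul_ne_zero (Ideal.ramificationIdx_pos q.1 ℤ).ne' (Ideal.inertiaDeg_pos q.1 ℤ).ne')
  have hle : ({Q₁, Q₂} : Finset (P.primesOver (𝓞 K))).sum (fun q ↦ q.1.ramificationIdx ℤ * q.1.inertiaDeg ℤ) ≤ 2 := by
    rw [← hsum]
    exact Finset.sum_le_sum_of_subset_of_nonneg (Finset.subset_univ _) (fun _ _ _ ↦ Nat.zero_le _)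
  rw [Finset.sum_pair hQne] at hle
  have g₁ := hge Q₁
  have g₂ := hge Q₂
  have h1 : 𝔭.asIdeal.ramificationIdx ℤ * 𝔭.asIdeal.inertiaDeg ℤ = 1 := by
    change Q₁.1.ramificationIdx ℤ * Q₁.1.inertiaDeg ℤ = 1
    omega
  exact ⟨Nat.eq_one_of_mul_eq_one_right h1, Nat.eq_one_of_mul_eq_one_left h1⟩

omit [Algebra K L] in
/-- **`√d ∉ K′` when `p` splits in `K′` but `d` is a non-square mod `p`**: a square root of `d` in `K` would force
residue degree `≥ 2` at every prime above `p` (`inertiaDeg_ne_one`), against `f(𝔭|p) = 1`. [cite: NeukirchANT1999, Ch. I §8] -/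
theorem not_exists_sq_eq_of_split (h2K : finrank ℚ K = 2) {d : ℤ} (hd : ¬ IsSquare ((d : ℤ) : ZMod p))
    {𝔭 𝔭' : HeightOneSpectrum (𝓞 K)} (h𝔭 : ((p : ℕ) : 𝓞 K) ∈ 𝔭.asIdeal) (h𝔭' : ((p : ℕ) : 𝓞 K) ∈ 𝔭'.asIdeal)
    (hne : 𝔭 ≠ 𝔭') : ¬ ∃ y : K, y ^ 2 = (d : K) := by
  rintro ⟨y, hy⟩
  obtain ⟨y₀, -, hy₀⟩ := exists_ringOfIntegers_sq_eq hy
  haveI := 𝔭.isPrime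
  exact inertiaDeg_ne_one hd hy₀ h𝔭 (ramificationIdx_inertiaDeg_eq_one_of_split h2K h𝔭 h𝔭' hne).2

omit hp [NumberField K] [NumberField L] in
/-- Hence `x = √d ∈ L` is not in (the image of) `K` — the hypothesis `hxK` of `isCMField`. [folklore] -/
theorem sqrt_not_mem_range {d : ℤ} (hK : ¬ ∃ y : K, y ^ 2 = (d : K)) {x : L} (hx : x ^ 2 = (d : L)) :
    x ∉ Set.range (algebraMap K L) := by
  rintro ⟨y, rfl⟩
  apply hK
  refine ⟨y, (algebraMap K L).injective ?_⟩
  rw [map_pow, hx, map_intCast]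

/-- **`𝔭` is INERT in `L/K`: the prime `𝔓` of `L` above `𝔭` has `e(𝔓|𝔭) = 1`, `f(𝔓|𝔭) = 2`** (multiplicativity of
`e`, `f` in the tower `ℤ ⊂ 𝓞 K ⊂ 𝓞 L` with `e(𝔓|p) = 1`, `f(𝔓|p) = 2`, `e(𝔭|p) = f(𝔭|p) = 1`).
[cite: NeukirchANT1999, Ch. I §8 (multiplicativity in towers)] -/
theorem ramificationIdx_inertiaDeg_relative (hK : IsImaginaryQuadratic K) (h2 : finrank K L = 2) {d : ℤ}
    (hd : ¬ IsSquare ((d : ℤ) : ZMod p)) {x : 𝓞 L} (hx : x ^ 2 = (d : 𝓞 L)) {𝔭 𝔭' : HeightOneSpectrum (𝓞 K)}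
    (h𝔭 : ((p : ℕ) : 𝓞 K) ∈ 𝔭.asIdeal) (h𝔭' : ((p : ℕ) : 𝓞 K) ∈ 𝔭'.asIdeal) (hne : 𝔭 ≠ 𝔭')
    {𝔓 : HeightOneSpectrum (𝓞 L)} [h𝔓 : 𝔓.asIdeal.LiesOver 𝔭.asIdeal] :
    𝔓.asIdeal.ramificationIdx (𝓞 K) = 1 ∧ 𝔓.asIdeal.inertiaDeg (𝓞 K) = 2 := by
  have h4 : finrank ℚ L = 4 := finrank_eq_four hK h2
  obtain ⟨𝔓', h'⟩ := exists_liesOver (L := L) 𝔭'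
  have hP := natCast_mem_of_liesOver (L := L) (𝔓 := 𝔓) h𝔭
  have hP' := natCast_mem_of_liesOver (L := L) (𝔓 := 𝔓') h𝔭'
  have hne' : 𝔓 ≠ 𝔓' := ne_of_liesOver_ne hne
  obtain ⟨-, hdeg⟩ := primes_above_eq_and_degrees h4 hd hx hP hP' hne'
  obtain ⟨he, hf⟩ := hdeg 𝔓 hP
  obtain ⟨heK, hfK⟩ := ramificationIdx_inertiaDeg_eq_one_of_split hK.1 h𝔭 h𝔭' hne
  haveI := 𝔭.isPrime
  haveI := 𝔓.isPrime
  haveI := liesOver_span_of_mem h𝔭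
  haveI := liesOver_span_of_mem hP
  have htf := Ideal.inertiaDeg_tower (R := ℤ) 𝔭.asIdeal 𝔓.asIdeal
  have hte := Ideal.ramificationIdx_tower (R := ℤ) 𝔭.asIdeal 𝔓.asIdeal
  rw [hf, hfK, one_mul] at htf
  rw [he, heK, one_mul] at hte
  exact ⟨hte.symm, htf.symm⟩

end Route

end Summit.BirchSwinnertonDyer.BirchSwinnertonDyer.Theorems.BiquadraticEisensteinDescentEisensteinHeartFlatCMInertBadKPrimeBiquadraticPrimes

end
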